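import Mathlib
import Summits.Ventures.HodgeRepro.Tier4.Line1.RTFSetting
import Summits.Ventures.HodgeRepro.Tier4.Line1.RtfGeometric

/-!
# Tier4/Line1/CentralVanishing — LINE L1: the central-character obstruction of the relative trace formula
(the kernel twin of the line's SCOPE CLAUSE)

Blind re-derivation cell `pub-hodge-repro`, Tier 4 «prove the step» (README §9–§10), seat t4-L1-p4 (gen 3; bus
S13375).  Imports ONLY Mathlib, the line's generic RTF layer `Tier4/Line1/RTFSetting.lean` (t4-plan-1, p662473) and
L1.1 `Tier4/Line1/RtfGeometric.lean` (t4-L1-p2, p663290).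

WHAT IS PROVED.  The skeleton's scope clause (Skeleton v0.27 → v0.32, docstring of `line1_realise`; t4-plan-1 S12943
(1)) states ON PAPER: «N2 is LOAD-BEARING, not decoration: for `z ∈ Z(𝔸)` the substitution `(t, t′) ↦ (zt, zt′)` in
`J(f) = ∫_{[T]}∫_{[T′]} K_f(t, t′) χ(t) conj χ′(t′)` gives `J(f) = ε(z) J(f)`, so for `ε ≢ 1` on `E¹(𝔸)` the whole RTF
distribution vanishes identically».  This module is that sentence in the kernel, on EVERY `RTF.Setting G` (no instance
is built, no adelic object is mentioned):

* `kernel_central_mul_left` — `K_f(zx, zy) = K_f(x, y)` for `z` central; `kernel_rational_mul_left` /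
  `kernel_rational_mul_right` — `K_f(γx, y) = K_f(x, y) = K_f(x, γy)` for `γ ∈ G(k)` (reindexing of the `tsum`);
* `setIntegral_DT_central_mul` / `setIntegral_DT'_central_mul` — the substitution `t ↦ zt` on `[T]`: for a left
  `T(k)`-invariant function the integral over the fundamental domain `DT` is unchanged, because `z·DT` is again a
  fundamental domain of `T(k)` (`z` central; Mathlib's `IsFundamentalDomain.image_of_equiv`) and two fundamental
  domains give the same integral of an invariant function (`IsFundamentalDomain.setIntegral_eq`, which needs NO
  integrability — so every statement below holds for EVERY `f : G → ℂ`, test function or not);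
* **`J_eq_mul_J_of_central`** — `J(f) = χ(z) · conj χ′(z) · J(f)` for every central `z ∈ Z` and every `f`;
* **`J_eq_zero_of_ne_on_centre`** — if `χ(z) ≠ χ′(z)` for one `z ∈ Z`, then `J(f) = 0` for every `f`;
* **`centralMatch_of_J_ne_zero`** — `J(f) ≠ 0` forces N2 (`CentralMatch χ χ′`);
* **`centralMatch_of_isolated`** — the line's DEFINED content (`geoSupport f = {o₀}` and `orbital χ χ′ o₀ f ≠ 0`,
  the fields `hiso` / `hne` of the skeleton's `RTFDatum.Defined`) forces N2, through L1.1 `rtf_geometric`.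

WHAT THIS MEANS FOR THE LINE TABLE.  The «hidden hypothesis N2» of the costume (`RTFData.chi_centre`) is not a free
choice layered on the mechanism: on ANY datum the relative trace formula produces a non-zero distribution only when
`χ|_Z = χ′|_Z`.  Hence (a) the twist test of RULINGS II is decided by the mechanism itself — on data with `ε ≢ 1` on
the centre, `J ≡ 0` and every spectral product of toric periods against `(χ, χ′)` sums to zero; (b) the `chi_centre`
field is a CONSEQUENCE of the defined content `hiso ∧ hne` (`centralMatch_of_isolated`), so the line's defined half
already certifies N2.  Nothing here touches `P_T4`, the twisted member or the seesaw identification: the bridge from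
`J ≡ 0` to the corner characters of the concrete datum is the displayed identification (S1)–(S3), not this module.

Requires `[Countable S.Gk]` (the fundamental-domain integral lemmas of Mathlib sum over the acting group; on the line's
instance this is (I1-e) `rationalPoints_countable`).  Nothing here says anything about the status of the Hodge
conjecture for CM abelian varieties, which is NOT proved (HC_CM is NOT proved by anyone in this repository).
-/

set_option autoImplicit false

noncomputable section

namespace Summit.Ventures.HodgeRepro.Tier4.Line1

open MeasureTheory Topology

namespace RTF

variable {G : Type} [Group G] [TopologicalSpace G] [IsTopologicalGroup G] [MeasurableSpace G]
  [BorelSpace G]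

namespace Setting

variable (S : Setting G)

/-! ## Invariances of the kernel -/

omit [IsTopologicalGroup G] [BorelSpace G] in
/-- **The kernel is invariant under the simultaneous left translation of both variables by a central element**:
`K_f(zx, zy) = K_f(x, y)` for `z ∈ Z` (`z⁻¹ γ z = γ` term by term; no reindexing). -/
theorem kernel_central_mul_left (f : G → ℂ) {z : G} (hz : z ∈ S.Z) (x y : G) :
    S.kernel f (z * x) (z * y) = S.kernel f x y := by
  unfold kernel
  refine tsum_congr fun γ => ?_
  congr 1
  have hc : z⁻¹ * (γ : G) * z = γ := by
    rw [mul_assoc, ← S.central z hz γ, ← mul_assoc, inv_mul_cancel, one_mul]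
  calc (z * x)⁻¹ * γ * (z * y) = x⁻¹ * (z⁻¹ * γ * z) * y := by
        simp only [mul_inv_rev, mul_assoc]
    _ = x⁻¹ * γ * y := by rw [hc]

omit [IsTopologicalGroup G] [BorelSpace G] in
/-- **Left rational translation of the first variable**: `K_f(γx, y) = K_f(x, y)` for `γ ∈ G(k)` (reindex the sum
over `G(k)` by `δ ↦ γ⁻¹ δ`). -/
theorem kernel_rational_mul_left (f : G → ℂ) (γ : S.Gk) (x y : G) :
    S.kernel f ((γ : G) * x) y = S.kernel f x y := by
  unfold kernel
  have h : ∀ δ : S.Gk, f (((γ : G) * x)⁻¹ * δ * y) = f (x⁻¹ * ((γ⁻¹ * δ : S.Gk) : G) * y) := by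
    intro δ
    congr 1
    simp only [Subgroup.coe_mul, Subgroup.coe_inv, mul_inv_rev, mul_assoc]
  simp_rw [h]
  exact (Equiv.mulLeft γ⁻¹).tsum_eq (fun δ : S.Gk => f (x⁻¹ * (δ : G) * y))

omit [IsTopologicalGroup G] [BorelSpace G] in
/-- **Left rational translation of the second variable**: `K_f(x, γy) = K_f(x, y)` for `γ ∈ G(k)` (reindex by
`δ ↦ δ γ`). -/
theorem kernel_rational_mul_right (f : G → ℂ) (γ : S.Gk) (x y : G) :
    S.kernel f x ((γ : G) * y) = S.kernel f x y := by
  unfold kernel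
  have h : ∀ δ : S.Gk, f (x⁻¹ * δ * ((γ : G) * y)) = f (x⁻¹ * ((δ * γ : S.Gk) : G) * y) := by
    intro δ
    congr 1
    simp only [Subgroup.coe_mul, mul_assoc]
  simp_rw [h]
  exact (Equiv.mulRight γ).tsum_eq (fun δ : S.Gk => f (x⁻¹ * (δ : G) * y))

/-! ## The substitution `t ↦ zt` on `[T]` and on `[T′]` -/

omit [IsTopologicalGroup G] [BorelSpace G] in
/-- `T(k) = G(k) ∩ T` is countable when `G(k)` is (it embeds in `G(k)`). -/
theorem countable_subgroupOf_T [Countable S.Gk] : Countable (S.Gk.subgroupOf S.T) := by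
  refine Function.Injective.countable
    (f := fun g : S.Gk.subgroupOf S.T => (⟨((g : S.T) : G), Subgroup.mem_subgroupOf.mp g.2⟩ : S.Gk)) ?_
  intro a b hab
  have h := congrArg Subtype.val hab
  exact Subtype.ext (Subtype.ext h)

omit [IsTopologicalGroup G] [BorelSpace G] in
/-- `T′(k) = G(k) ∩ T′` is countable when `G(k)` is. -/
theorem countable_subgroupOf_T' [Countable S.Gk] : Countable (S.Gk.subgroupOf S.T') := by
  refine Function.Injective.countable
    (f := fun g : S.Gk.subgroupOf S.T' => (⟨((g : S.T') : G), Subgroup.mem_subgroupOf.mp g.2⟩ : S.Gk)) ?_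
  intro a b hab
  have h := congrArg Subtype.val hab
  exact Subtype.ext (Subtype.ext h)

omit [IsTopologicalGroup G] [BorelSpace G] in
/-- A central `z ∈ Z`, read in `T`, commutes with the action of `T(k)` on `T`. -/
theorem central_smul_comm_T {z : G} (hz : z ∈ S.Z) (g : S.Gk.subgroupOf S.T) (t : S.T) :
    (⟨z, S.ZleT hz⟩ : S.T) * (g • t) = g • ((⟨z, S.ZleT hz⟩ : S.T) * t) := by
  rw [Subgroup.smul_def, Subgroup.smul_def, smul_eq_mul, smul_eq_mul]
  apply Subtype.ext
  show z * (((g : S.T) : G) * (t : G)) = ((g : S.T) : G) * (z * (t : G))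
  rw [← mul_assoc, S.central z hz _, mul_assoc]

omit [IsTopologicalGroup G] [BorelSpace G] in
/-- A central `z ∈ Z`, read in `T′`, commutes with the action of `T′(k)` on `T′`. -/
theorem central_smul_comm_T' {z : G} (hz : z ∈ S.Z) (g : S.Gk.subgroupOf S.T') (t : S.T') :
    (⟨z, S.ZleT' hz⟩ : S.T') * (g • t) = g • ((⟨z, S.ZleT' hz⟩ : S.T') * t) := by
  rw [Subgroup.smul_def, Subgroup.smul_def, smul_eq_mul, smul_eq_mul]
  apply Subtype.ext
  show z * (((g : S.T') : G) * (t : G)) = ((g : S.T') : G) * (z * (t : G))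
  rw [← mul_assoc, S.central z hz _, mul_assoc]

/-- **The translate `z·DT` of the fundamental domain of `T(k)` in `T` is again a fundamental domain** (`z ∈ Z`
central: `γ·(z·DT) = z·(γ·DT)`, and left translation preserves the Haar measure `μT`). -/
theorem isFundamentalDomain_central_mul_DT {z : G} (hz : z ∈ S.Z) :
    IsFundamentalDomain (S.Gk.subgroupOf S.T) ((fun t : S.T => (⟨z, S.ZleT hz⟩ : S.T) * t) '' S.DT) S.μT := by
  haveI := S.haarT
  have h := S.fdT.image_of_equiv (Equiv.mulLeft (⟨z, S.ZleT hz⟩ : S.T))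
    (by
      rw [Equiv.mulLeft_symm, Equiv.coe_mulLeft]
      exact (measurePreserving_mul_left S.μT _).quasiMeasurePreserving)
    (Equiv.refl _) (fun g t => S.central_smul_comm_T hz g t)
  simpa only [Equiv.coe_mulLeft] using h

/-- **The translate `z·DT′` of the fundamental domain of `T′(k)` in `T′` is again a fundamental domain.** -/
theorem isFundamentalDomain_central_mul_DT' {z : G} (hz : z ∈ S.Z) :
    IsFundamentalDomain (S.Gk.subgroupOf S.T') ((fun t : S.T' => (⟨z, S.ZleT' hz⟩ : S.T') * t) '' S.DT') S.μT' := by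
  haveI := S.haarT'
  have h := S.fdT'.image_of_equiv (Equiv.mulLeft (⟨z, S.ZleT' hz⟩ : S.T'))
    (by
      rw [Equiv.mulLeft_symm, Equiv.coe_mulLeft]
      exact (measurePreserving_mul_left S.μT' _).quasiMeasurePreserving)
    (Equiv.refl _) (fun g t => S.central_smul_comm_T' hz g t)
  simpa only [Equiv.coe_mulLeft] using h

/-- **The substitution `t ↦ zt` on `[T]`**: for a central `z ∈ Z` and a left-`T(k)`-invariant function `F` on `T`,
`∫_{DT} F(zt) dμT(t) = ∫_{DT} F(t) dμT(t)` — the translated integral is the integral over the fundamental domain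
`z·DT`, and two fundamental domains give the same integral of an invariant function.  No integrability is assumed. -/
theorem setIntegral_DT_central_mul [Countable S.Gk] {z : G} (hz : z ∈ S.Z) (F : S.T → ℂ)
    (hF : ∀ (g : S.Gk.subgroupOf S.T) (t : S.T), F (g • t) = F t) :
    ∫ t in S.DT, F ((⟨z, S.ZleT hz⟩ : S.T) * t) ∂S.μT = ∫ t in S.DT, F t ∂S.μT := by
  haveI := S.countable_subgroupOf_T
  haveI := S.haarT
  have hemb : MeasurableEmbedding (fun t : S.T => (⟨z, S.ZleT hz⟩ : S.T) * t) :=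
    (MeasurableEquiv.mulLeft (⟨z, S.ZleT hz⟩ : S.T)).measurableEmbedding
  calc ∫ t in S.DT, F ((⟨z, S.ZleT hz⟩ : S.T) * t) ∂S.μT
      = ∫ t in (fun t : S.T => (⟨z, S.ZleT hz⟩ : S.T) * t) '' S.DT, F t ∂S.μT :=
        ((measurePreserving_mul_left S.μT (⟨z, S.ZleT hz⟩ : S.T)).setIntegral_image_emb hemb F S.DT).symm
    _ = ∫ t in S.DT, F t ∂S.μT :=
        (S.isFundamentalDomain_central_mul_DT hz).setIntegral_eq S.fdT hF

/-- **The substitution `t′ ↦ zt′` on `[T′]`** (the twin of `setIntegral_DT_central_mul`). -/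
theorem setIntegral_DT'_central_mul [Countable S.Gk] {z : G} (hz : z ∈ S.Z) (F : S.T' → ℂ)
    (hF : ∀ (g : S.Gk.subgroupOf S.T') (t : S.T'), F (g • t) = F t) :
    ∫ t in S.DT', F ((⟨z, S.ZleT' hz⟩ : S.T') * t) ∂S.μT' = ∫ t in S.DT', F t ∂S.μT' := by
  haveI := S.countable_subgroupOf_T'
  haveI := S.haarT'
  have hemb : MeasurableEmbedding (fun t : S.T' => (⟨z, S.ZleT' hz⟩ : S.T') * t) :=
    (MeasurableEquiv.mulLeft (⟨z, S.ZleT' hz⟩ : S.T')).measurableEmbedding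
  calc ∫ t in S.DT', F ((⟨z, S.ZleT' hz⟩ : S.T') * t) ∂S.μT'
      = ∫ t in (fun t : S.T' => (⟨z, S.ZleT' hz⟩ : S.T') * t) '' S.DT', F t ∂S.μT' :=
        ((measurePreserving_mul_left S.μT' (⟨z, S.ZleT' hz⟩ : S.T')).setIntegral_image_emb hemb F S.DT').symm
    _ = ∫ t in S.DT', F t ∂S.μT' :=
        (S.isFundamentalDomain_central_mul_DT' hz).setIntegral_eq S.fdT' hF

/-! ## The central-character identity of `J` and its consequences -/

/-- **`J(f) = χ(z) · conj χ′(z) · J(f)` for every central `z ∈ Z` and EVERY `f : G → ℂ`** — the scope clause's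
displayed identity: substitute `t′ ↦ zt′` in the inner integral (the integrand is left-`T′(k)`-invariant in `t′`:
`K_f(t, γt′) = K_f(t, t′)`, `χ′(γt′) = χ′(t′)`), then `t ↦ zt` in the outer one (left-`T(k)`-invariant in `t`), and
use `K_f(zt, zt′) = K_f(t, t′)`, `χ(zt) = χ(z)χ(t)`, `χ′(zt′) = χ′(z)χ′(t′)`. -/
theorem J_eq_mul_J_of_central [Countable S.Gk] {χ : S.T → ℂ} {χ' : S.T' → ℂ}
    (hχ : S.IsCharacter χ) (hχ' : S.IsCharacter' χ') {z : G} (hz : z ∈ S.Z) (f : G → ℂ) :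
    S.J χ χ' f = χ ⟨z, S.ZleT hz⟩ * starRingEnd ℂ (χ' ⟨z, S.ZleT' hz⟩) * S.J χ χ' f := by
  set zT : S.T := ⟨z, S.ZleT hz⟩ with hzT
  set zT' : S.T' := ⟨z, S.ZleT' hz⟩ with hzT'
  set c : ℂ := χ zT * starRingEnd ℂ (χ' zT') with hc
  -- Step 1: the inner substitution `t′ ↦ zt′`, for every `t`.
  have step1 : ∀ t : S.T,
      ∫ t' in S.DT', S.kernel f t t' * χ t * starRingEnd ℂ (χ' t') ∂S.μT' =
      ∫ t' in S.DT', S.kernel f t (zT' * t') * χ t * starRingEnd ℂ (χ' (zT' * t')) ∂S.μT' := by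
    intro t
    refine (S.setIntegral_DT'_central_mul hz
      (fun t' : S.T' => S.kernel f t t' * χ t * starRingEnd ℂ (χ' t')) ?_).symm
    intro g t'
    have hg : ((g : S.T') : G) ∈ S.Gk := Subgroup.mem_subgroupOf.mp g.2
    have hk : S.kernel f t ((g • t' : S.T') : G) = S.kernel f t t' := by
      rw [Subgroup.smul_def, smul_eq_mul, Subgroup.coe_mul]
      exact S.kernel_rational_mul_right f ⟨_, hg⟩ t t'
    have hχg : χ' (g • t') = χ' t' := by
      rw [Subgroup.smul_def, smul_eq_mul, hχ'.map_mul, hχ'.rational _ g.2, one_mul]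
    simp only [hk, hχg]
  -- Step 2: the outer substitution `t ↦ zt`.
  have step2 :
      ∫ t in S.DT, (∫ t' in S.DT', S.kernel f t (zT' * t') * χ t * starRingEnd ℂ (χ' (zT' * t')) ∂S.μT') ∂S.μT =
      ∫ t in S.DT, (∫ t' in S.DT', S.kernel f (zT * t) (zT' * t') * χ (zT * t) *
        starRingEnd ℂ (χ' (zT' * t')) ∂S.μT') ∂S.μT := by
    refine (S.setIntegral_DT_central_mul hz
      (fun t : S.T => ∫ t' in S.DT', S.kernel f t (zT' * t') * χ t * starRingEnd ℂ (χ' (zT' * t')) ∂S.μT')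
      ?_).symm
    intro g t
    have hg : ((g : S.T) : G) ∈ S.Gk := Subgroup.mem_subgroupOf.mp g.2
    have hk : ∀ t' : S.T', S.kernel f ((g • t : S.T) : G) ((zT' : G) * t') =
        S.kernel f t ((zT' : G) * t') := by
      intro t'
      rw [Subgroup.smul_def, smul_eq_mul, Subgroup.coe_mul]
      exact S.kernel_rational_mul_left f ⟨_, hg⟩ t (zT' * t')
    have hχg : χ (g • t) = χ t := by
      rw [Subgroup.smul_def, smul_eq_mul, hχ.map_mul, hχ.rational _ g.2, one_mul]
    simp only [hk, hχg]
  -- Step 3: the translated integrand is `c` times the original one.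
  have step3 : ∀ (t : S.T) (t' : S.T'),
      S.kernel f (zT * t) (zT' * t') * χ (zT * t) * starRingEnd ℂ (χ' (zT' * t')) =
      c * (S.kernel f t t' * χ t * starRingEnd ℂ (χ' t')) := by
    intro t t'
    have hk : S.kernel f ((zT : G) * t) ((zT' : G) * t') = S.kernel f t t' :=
      S.kernel_central_mul_left f hz t t'
    rw [hk, hχ.map_mul, hχ'.map_mul, map_mul, hc]
    ring
  -- Assembly.
  unfold J
  calc ∫ t in S.DT, ∫ t' in S.DT', S.kernel f t t' * χ t * starRingEnd ℂ (χ' t') ∂S.μT' ∂S.μT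
      = ∫ t in S.DT, ∫ t' in S.DT', S.kernel f t (zT' * t') * χ t * starRingEnd ℂ (χ' (zT' * t'))
          ∂S.μT' ∂S.μT := by
        simp only [step1]
    _ = ∫ t in S.DT, ∫ t' in S.DT', S.kernel f (zT * t) (zT' * t') * χ (zT * t) *
          starRingEnd ℂ (χ' (zT' * t')) ∂S.μT' ∂S.μT := step2
    _ = ∫ t in S.DT, ∫ t' in S.DT', c * (S.kernel f t t' * χ t * starRingEnd ℂ (χ' t')) ∂S.μT' ∂S.μT := by
        simp only [step3]
    _ = c * ∫ t in S.DT, ∫ t' in S.DT', S.kernel f t t' * χ t * starRingEnd ℂ (χ' t') ∂S.μT' ∂S.μT := by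
        simp only [integral_const_mul]

/-- **The distribution vanishes identically when the characters differ on the centre**: if `χ(z) ≠ χ′(z)` for one
`z ∈ Z`, then `J(f) = 0` for EVERY `f : G → ℂ` (`J = c·J` with `c = χ(z) conj χ′(z) ≠ 1`, since `‖χ′(z)‖ = 1`). -/
theorem J_eq_zero_of_ne_on_centre [Countable S.Gk] {χ : S.T → ℂ} {χ' : S.T' → ℂ}
    (hχ : S.IsCharacter χ) (hχ' : S.IsCharacter' χ') {z : G} (hz : z ∈ S.Z)
    (hne : χ ⟨z, S.ZleT hz⟩ ≠ χ' ⟨z, S.ZleT' hz⟩) (f : G → ℂ) : S.J χ χ' f = 0 := by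
  have h := S.J_eq_mul_J_of_central hχ hχ' hz f
  set c : ℂ := χ ⟨z, S.ZleT hz⟩ * starRingEnd ℂ (χ' ⟨z, S.ZleT' hz⟩) with hc
  have hunit : χ' ⟨z, S.ZleT' hz⟩ * starRingEnd ℂ (χ' ⟨z, S.ZleT' hz⟩) = 1 := by
    rw [Complex.mul_conj, Complex.normSq_eq_norm_sq, hχ'.unit]
    simp
  have hc1 : c ≠ 1 := by
    intro h1
    apply hne
    calc χ ⟨z, S.ZleT hz⟩
        = χ ⟨z, S.ZleT hz⟩ * (χ' ⟨z, S.ZleT' hz⟩ * starRingEnd ℂ (χ' ⟨z, S.ZleT' hz⟩)) := by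
          rw [hunit, mul_one]
      _ = (χ ⟨z, S.ZleT hz⟩ * starRingEnd ℂ (χ' ⟨z, S.ZleT' hz⟩)) * χ' ⟨z, S.ZleT' hz⟩ := by ring
      _ = χ' ⟨z, S.ZleT' hz⟩ := by rw [← hc, h1, one_mul]
  have h0 : (1 - c) * S.J χ χ' f = 0 := by
    rw [sub_mul, one_mul, ← h, sub_self]
  rcases mul_eq_zero.mp h0 with h1 | h1
  · exact absurd (sub_eq_zero.mp h1).symm hc1
  · exact h1

/-- **A non-zero distribution forces N2**: `J(f) ≠ 0` for one `f` implies `χ = χ′` on the centre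
(`CentralMatch χ χ′`). -/
theorem centralMatch_of_J_ne_zero [Countable S.Gk] {χ : S.T → ℂ} {χ' : S.T' → ℂ}
    (hχ : S.IsCharacter χ) (hχ' : S.IsCharacter' χ') {f : G → ℂ} (hJ : S.J χ χ' f ≠ 0) :
    S.CentralMatch χ χ' := by
  intro z hz
  by_contra hne
  exact hJ (S.J_eq_zero_of_ne_on_centre hχ hχ' hz hne f)

/-- **The line's DEFINED content forces N2**: a test function whose geometric support is one rational double coset
`o₀` with a non-zero orbital term (the fields `hiso` / `hne` of the skeleton's `RTFDatum.Defined`) has `J(f) =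
orbital(o₀) ≠ 0` by L1.1 `rtf_geometric`, hence `χ = χ′` on the centre.  The `chi_centre` field of the adelic data
is therefore a consequence of the defined content on any datum, not a free choice. -/
theorem centralMatch_of_isolated [Countable S.Gk] {χ : S.T → ℂ} {χ' : S.T' → ℂ}
    (hχ : S.IsCharacter χ) (hχ' : S.IsCharacter' χ') {f : G → ℂ} (hf : IsTest f) {o₀ : S.Orbit}
    (hiso : S.geoSupport f = {o₀}) (hne : S.orbital χ χ' o₀ f ≠ 0) : S.CentralMatch χ χ' := by
  apply S.centralMatch_of_J_ne_zero hχ hχ'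
  rw [S.rtf_geometric hχ hχ' hf, finsum_eq_single (fun o => S.orbital χ χ' o f) o₀]
  · exact hne
  · intro o ho
    apply S.orbital_eq_zero_of_not_mem
    rw [hiso]
    simpa using ho

end Setting

end RTF

end Summit.Ventures.HodgeRepro.Tier4.Line1

end
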